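/-
b2b-lace packet, ANALYTIC ORACLE seat gen 8 (unit `b2b-lace-oracle-g8`).  Leaf L0 of the (S2b)-IMPR interface
(HOME/GAPS.md "(S2b) SPLIT", item (I1)): the simplified NoBLE form WITH THE FULL Assumption 2.7 of [NoBLE17] —
the five constants `c̲_Φ, ᾱ_F, β_{R,F}, β_{ΔR,Φ}, β_{|ΔR,F|}` that the bound on `f₃` (§3.3.4–3.3.5) consumes and
that the tree's `NobleSimplifiedFormAt` (made for `f₁, f₂`) omits.  A DEFINITION module: d-generic, no numeral,
no dimension sentence, nothing cited as a fact.
-/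
import Literature.Barriers.CriticalPhenomena.GaussianDominationRouteNobleAnalysis
import Literature.Probability.FitznerVanDerHofstad2017.F3Bounds
import Literature.Probability.RandomPlanarGeometry.BDGS2012MeanSqDisplacement
import HarnessLib

/-!
# The simplified NoBLE form with the complete Assumption 2.7 (the input of the `f₃` improvement)

CITATION HEADER (PLACEMENT v2). Part of a certified REPRODUCTION of R. Fitzner, R. van der Hofstad,
*Generalized approach to the non-backtracking lace expansion*, Probab. Theory Related Fields 169 (2017)
1041–1119 [NoBLE17] (arXiv:1506.07969), Assumption 2.7 and §3.3.4–3.3.5, as consumed by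
*Mean-field behavior for nearest-neighbor percolation in `d > 10`*, Electron. J. Probab. 22 (2017) no. 43
[FvdH17], Prop. 2.2 / §3.3.

## The printed assumption (verbatim, [NoBLE17] Assumption 2.7 "Diagrammatic bounds", PTRF pp. 1059–1060)

> "Let `Γ₁, Γ₂, Γ₃ ≥ 0`. Assume that `z ∈ (z_I, z_c)` is such that `f_i(z) ≤ Γ_i` holds for all `i ∈ {1,2,3}`.
> Then, `Ĝ_z(k) ≥ 0` for all `k ∈ (−π,π)^d`, and the following bounds hold with `β_•` depending only on
> `Γ₁, Γ₂, Γ₃, d` and the model: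
> (a) There exist `β_μ̄ > 1`, `α̲_F, ᾱ_F, β_{α,Φ}, c̲_Φ, c̄_Φ > 0`, such that
>     `μ̄_z/μ_z ≤ β_μ̄`,  `c̲_Φ ≤ c_{Φ,z} ≤ c̄_Φ`,  `α̲_F ≤ α_{F,z} ≤ ᾱ_F`,  `|α_{Φ,z}| ≤ β_{α,Φ}`.
> (b) There exist `β̄_Π, β̲_Ψ > 0`, such that `Σ_{x,κ} Π^{ι,κ}_z(x) ≤ β̄_Π`, `Σ_x Ψ^κ_z(x) ≥ −β̲_Ψ`.
> (c) There exist `β_{R,F}, β_{R,Φ}, β_{ΔR,Φ}, β_{|ΔR,F|}, β̲_{ΔR,F} > 0` such that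
>     `Σ_x |R_{F,z}(x)| ≤ β_{R,F}`,  `Σ_x |R_{Φ,z}(x)| ≤ β_{R,Φ}`,
>     `Σ_x ‖x‖₂² |R_{Φ,z}(x)| ≤ β_{ΔR,Φ}`,  `Σ_x ‖x‖₂² |R_{F,z}(x)| ≤ β_{|ΔR,F|}`,
>     `R̂_{F,z}(0) − R̂_{F,z}(k) ≥ −β̲_{ΔR,F} [1 − D̂(k)]`,
> for all `k ∈ (−π,π)^d`. Further, we assume that `α̲_F − β̲_{ΔR,F} > 0` and `c̲_Φ − β_{α,Φ} − β_{R,Φ} > 0`."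

## What is here

* `NobleBetaF3` — the five constants of (a), (c) absent from the tree's `NobleBeta` (which carries the eight used by
  `f₁, f₂`: `β_μ̄, β̄_Π, β_Ψ, c̄_Φ, β_{α,Φ}, β_{R,Φ}, α̲_F, β̲_{ΔR,F}`), in the order of `BetaMap.extraOfInputs`
  (`c̲_Φ` (D.2) lower, `ᾱ_F` (D.3) upper, `β_{R,F}` (D.13), `β_{ΔR,Φ}` (D.21), `β_{|ΔR,F|}` (D.29), App. D
  pp. 1110–1117, as tagged in `BetaMap`);
  `NobleBetaF3.ofFn` reads them off a `Fin 5 → ℝ`.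
* `NobleSimplifiedFormF3At d p B E` — the tree's `NobleSimplifiedFormAt d p B`
  (`GaussianDominationRouteNobleAnalysis`) over the SAME witnesses `c_Φ, α_Φ, c_F, α_F, ψ, π, λ, R_Φ, R_F`, with the
  five further conjuncts of Assumption 2.7: `c̲_Φ ≤ c_Φ`, `α_F ≤ ᾱ_F`, `Σ|R_F| ≤ β_{R,F}`,
  `Σ‖x‖²|R_Φ| ≤ β_{ΔR,Φ}`, `Σ‖x‖²|R_F| ≤ β_{|ΔR,F|}` — the two weighted sums WITH their summability (a `tsum` of a
  non-summable family is `0` in Lean, which would make the printed inequality vacuous).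
* `NobleSimplifiedFormF3At.toSimplifiedFormAt` — the projection, so that everything proved from the eight-constant
  form (`NobleSimplifiedFormAt.nobleF1_le_and_nobleF2_le`, the `f₁, f₂` improvement) applies verbatim.
* `NobleBetaF3.Further` — the second printed side condition `c̲_Φ − β_{α,Φ} − β_{R,Φ} > 0` (the first,
  `α̲_F − β̲_{ΔR,F} > 0`, is the tree's `NobleBeta.Admissible`, conjunct `βΔ < αFlow`).
* `NobleBetaF3.toArgs` — the DICTIONARY to the ten `β`-arguments `F3Bounds.Args` of the typed bound map
  (3.71)–(3.87) (`F3Bounds.boundH1..5`): `Γ₂′ = ((2d−2)/(2d−1))Γ₂` ([NoBLE17] §3.3.4, "Bounds on key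
  quantities": "and from now on abbreviate `Γ₂′ = ((2d−2)/(2d−1))Γ₂`"), `K̲ = 1/(α̲_F − β̲_{ΔR,F})` (same
  paragraph: "we define `K̲ = 1/(α̲_F − β̲_{ΔR,F})`, so that `1/(1 − F̂_z(k)) ≤ K̲ Ĉ(k)`"), the other eight read
  off `B`, `E`.

Nothing here asserts that the form holds for percolation: that is [NoBLE17] App. D / [FvdH17] Prop. 2.2 (the
App.-D side of the five constants is leaf L0b), and the theorem "form + `f ≤ Γ` ⇒ weighted-diagram bounds" is
§3.3.5 (leaves L1–L8).  This file only fixes the TYPE those leaves meet at.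
-/

noncomputable section

open MeasureTheory
open scoped BigOperators

namespace Literature.Probability.FitznerVanDerHofstad2017

open Literature.Barriers.CriticalPhenomena Literature.Probability.Percolation
open Literature.Probability.LatticeModels
open Literature.Probability.RandomPlanarGeometry.SAW.Zd (normSq normSq_nonneg)

variable {d : ℕ}

/-- The five constants of [NoBLE17] Assumption 2.7 (a), (c) that the `f₃`-bound consumes and `NobleBeta` omits,
in the order of `BetaMap.extraOfInputs`. [cite: FitznerVanDerHofstad2016NoBLE, Assumption 2.7 (a), (c), PTRF pp. 1059–1060] -/
structure NobleBetaF3 where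
  /-- `c̲_Φ`: `c̲_Φ ≤ c_{Φ,z}` ((a); App. D (D.2) lower). -/
  cΦlow : ℝ
  /-- `ᾱ_F`: `α_{F,z} ≤ ᾱ_F` ((a); App. D (D.3) upper). -/
  αFup : ℝ
  /-- `β_{R,F}`: `Σ_x |R_{F,z}(x)| ≤ β_{R,F}` ((c); App. D (D.13)). -/
  βRF : ℝ
  /-- `β_{ΔR,Φ}`: `Σ_x ‖x‖₂² |R_{Φ,z}(x)| ≤ β_{ΔR,Φ}` ((c); App. D (D.21)). -/
  βΔRΦ : ℝ
  /-- `β_{|ΔR,F|}`: `Σ_x ‖x‖₂² |R_{F,z}(x)| ≤ β_{|ΔR,F|}` ((c); App. D (D.29)). -/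
  βΔRFabs : ℝ

/-- Read the five constants off a vector in the order of `BetaMap.extraOfInputs`
(`c̲_Φ, ᾱ_F, β_{R,F}, β_{ΔR,Φ}, β_{|ΔR,F|}`). [folklore] -/
def NobleBetaF3.ofFn (e : Fin 5 → ℝ) : NobleBetaF3 :=
  ⟨e 0, e 1, e 2, e 3, e 4⟩

/-- Component `0` of `ofFn` is `c̲_Φ`. [folklore] -/
@[simp] theorem NobleBetaF3.ofFn_cΦlow (e : Fin 5 → ℝ) : (NobleBetaF3.ofFn e).cΦlow = e 0 := rfl
/-- Component `1` of `ofFn` is `ᾱ_F`. [folklore] -/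
@[simp] theorem NobleBetaF3.ofFn_αFup (e : Fin 5 → ℝ) : (NobleBetaF3.ofFn e).αFup = e 1 := rfl
/-- Component `2` of `ofFn` is `β_{R,F}`. [folklore] -/
@[simp] theorem NobleBetaF3.ofFn_βRF (e : Fin 5 → ℝ) : (NobleBetaF3.ofFn e).βRF = e 2 := rfl
/-- Component `3` of `ofFn` is `β_{ΔR,Φ}`. [folklore] -/
@[simp] theorem NobleBetaF3.ofFn_βΔRΦ (e : Fin 5 → ℝ) : (NobleBetaF3.ofFn e).βΔRΦ = e 3 := rfl
/-- Component `4` of `ofFn` is `β_{|ΔR,F|}`. [folklore] -/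
@[simp] theorem NobleBetaF3.ofFn_βΔRFabs (e : Fin 5 → ℝ) : (NobleBetaF3.ofFn e).βΔRFabs = e 4 := rfl

/-- The second side condition of Assumption 2.7: "Further, we assume that … `c̲_Φ − β_{α,Φ} − β_{R,Φ} > 0`"
(the first, `α̲_F − β̲_{ΔR,F} > 0`, is `NobleBeta.Admissible`'s conjunct `βΔ < αFlow`).
[cite: FitznerVanDerHofstad2016NoBLE, Assumption 2.7 (the line following (c)), PTRF p. 1060] -/
def NobleBetaF3.Further (B : NobleBeta) (E : NobleBetaF3) : Prop :=
  B.βαΦ + B.βRΦ < E.cΦlow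

/-- **The simplified NoBLE form of `τ̂_p` with the COMPLETE Assumption 2.7 bounds, at a parameter `p`, for
constants `B` (the eight of `NobleBeta`) and `E` (the five of `NobleBetaF3`)**: the witnesses and the first
seventeen conjuncts are VERBATIM those of `NobleSimplifiedFormAt d p B` (reals `c_Φ, α_Φ, c_F, α_F`, summable
`R_Φ, R_F : ℤ^d → ℝ` with `τ̂_p(k)(1 − F̂(k)) = Φ̂(k)` on `[−π,π]^d`; `ψ, π, λ` with the Lemma 3.1 link, `0 ≤ λ`,
`(2d−1)λ < 1`; (a) `μ̄_p = p ≤ β_μ̄ μ_p`, `0 ≤ c_Φ ≤ c̄_Φ`, `|α_Φ| ≤ β_{α,Φ}`, `α̲_F ≤ α_F`; (b) `π ≤ β̄_Π`,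
`−β_Ψ ≤ ψ`; (c) `Σ|R_Φ| ≤ β_{R,Φ}`, `R̂_F(0) − R̂_F(k) ≥ −β̲_{ΔR,F}[1 − D̂(k)]`), followed by the remaining bounds
of Assumption 2.7: (a) `c̲_Φ ≤ c_Φ`, `α_F ≤ ᾱ_F`; (c) `Σ_x |R_F(x)| ≤ β_{R,F}`, `Σ_x ‖x‖₂² |R_Φ(x)| ≤ β_{ΔR,Φ}`,
`Σ_x ‖x‖₂² |R_F(x)| ≤ β_{|ΔR,F|}`, the two weighted families being summable (`‖x‖₂² = normSq x`).
[cite: FitznerVanDerHofstad2016NoBLE, §1.3 (simplified NoBLE form), Lemma 3.1, Assumption 2.7 (a)–(c), PTRF pp. 1059–1060, §4.1]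
[cite: FitznerVanDerHofstad2017, §2.4 (μ̄_p = p, μ_p) and §2.3 (NoBLE equation)] -/
def NobleSimplifiedFormF3At (d : ℕ) (p : unitInterval) (B : NobleBeta) (E : NobleBetaF3) : Prop :=
  ∃ (cΦ αΦ cF αF ψ π lam : ℝ) (RΦ RF : Site d → ℝ), Summable RΦ ∧ Summable RF ∧
    (∀ k ∈ cube d, tauHat d p k * (1 - (cF + αF * Dhat d k + cosFT RF k)) =
      cΦ + αΦ * Dhat d k + cosFT RΦ k) ∧
    nobleMu d p = (1 + π) * lam / (1 + ψ * (1 + lam)) ∧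
    cF + αF + cosFT RF 0 = 2 * d * lam / (1 + lam) ∧ 0 ≤ lam ∧ (2 * d - 1) * lam < 1 ∧
    (p : ℝ) ≤ B.βμ * nobleMu d p ∧ 0 ≤ cΦ ∧ cΦ ≤ B.cΦup ∧ |αΦ| ≤ B.βαΦ ∧ B.αFlow ≤ αF ∧
    π ≤ B.βPi ∧ -B.βΨ ≤ ψ ∧
    ∑' x, |RΦ x| ≤ B.βRΦ ∧
    (∀ k ∈ cube d, -(B.βΔ * (1 - Dhat d k)) ≤ cosFT RF 0 - cosFT RF k) ∧
    E.cΦlow ≤ cΦ ∧ αF ≤ E.αFup ∧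
    ∑' x, |RF x| ≤ E.βRF ∧
    Summable (fun x => normSq x * |RΦ x|) ∧ ∑' x, normSq x * |RΦ x| ≤ E.βΔRΦ ∧
    Summable (fun x => normSq x * |RF x|) ∧ ∑' x, normSq x * |RF x| ≤ E.βΔRFabs

/-- The projection onto the eight-constant form used by the `f₁, f₂` analysis: the extended form literally
contains it. [folklore] -/
theorem NobleSimplifiedFormF3At.toSimplifiedFormAt {p : unitInterval} {B : NobleBeta} {E : NobleBetaF3}
    (h : NobleSimplifiedFormF3At d p B E) : NobleSimplifiedFormAt d p B := by
  obtain ⟨cΦ, αΦ, cF, αF, ψ, π, lam, RΦ, RF, hRΦ, hRF, hform, hμ, hF0, hlam0, hlam1, hratio, hcΦ0,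
    hcΦ, hαΦ, hαF, hπ, hψ, hRΦle, hRFb, -, -, -, -, -, -, -⟩ := h
  exact ⟨cΦ, αΦ, cF, αF, ψ, π, lam, RΦ, RF, hRΦ, hRF, hform, hμ, hF0, hlam0, hlam1, hratio, hcΦ0,
    hcΦ, hαΦ, hαF, hπ, hψ, hRΦle, hRFb⟩

/-- Hence the `f₁, f₂` improvement (Lemmas 3.2 and 3.4) holds under the extended form as well (`d ≥ 2`,
`c_μ ≥ 0`, admissible `B`). [cite: FitznerVanDerHofstad2016NoBLE, Lemma 3.2 and Lemma 3.4] -/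
theorem NobleSimplifiedFormF3At.nobleF1_le_and_nobleF2_le (hd : 2 ≤ d) {p : unitInterval}
    {B : NobleBeta} {E : NobleBetaF3} (hB : B.Admissible d) {cμ : ℝ} (hcμ : 0 ≤ cμ)
    (h : NobleSimplifiedFormF3At d p B E) :
    nobleF1 d cμ p ≤ B.f1Bound d cμ ∧ nobleF2 d p ≤ B.f2Bound d :=
  h.toSimplifiedFormAt.nobleF1_le_and_nobleF2_le hd hB hcμ

/-- The five further bounds, extracted (with the witnesses' summabilities), for use by the `f₃` analysis:
under the extended form there are witnesses with `c̲_Φ ≤ c_Φ ≤ c̄_Φ`, `α̲_F ≤ α_F ≤ ᾱ_F`, `|α_Φ| ≤ β_{α,Φ}`,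
`Σ|R_Φ| ≤ β_{R,Φ}`, `Σ|R_F| ≤ β_{R,F}`, `Σ‖x‖²|R_Φ| ≤ β_{ΔR,Φ}`, `Σ‖x‖²|R_F| ≤ β_{|ΔR,F|}` and the lower bound on
`R̂_F(0) − R̂_F(k)`, satisfying the form identity. [cite: FitznerVanDerHofstad2016NoBLE, Assumption 2.7 (a), (c), PTRF pp. 1059–1060] -/
theorem NobleSimplifiedFormF3At.exists_coefficients {p : unitInterval} {B : NobleBeta} {E : NobleBetaF3}
    (h : NobleSimplifiedFormF3At d p B E) :
    ∃ (cΦ αΦ cF αF : ℝ) (RΦ RF : Site d → ℝ), Summable RΦ ∧ Summable RF ∧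
      (∀ k ∈ cube d, tauHat d p k * (1 - (cF + αF * Dhat d k + cosFT RF k)) =
        cΦ + αΦ * Dhat d k + cosFT RΦ k) ∧
      E.cΦlow ≤ cΦ ∧ cΦ ≤ B.cΦup ∧ |αΦ| ≤ B.βαΦ ∧ B.αFlow ≤ αF ∧ αF ≤ E.αFup ∧
      ∑' x, |RΦ x| ≤ B.βRΦ ∧ ∑' x, |RF x| ≤ E.βRF ∧
      Summable (fun x => normSq x * |RΦ x|) ∧ ∑' x, normSq x * |RΦ x| ≤ E.βΔRΦ ∧
      Summable (fun x => normSq x * |RF x|) ∧ ∑' x, normSq x * |RF x| ≤ E.βΔRFabs ∧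
      (∀ k ∈ cube d, -(B.βΔ * (1 - Dhat d k)) ≤ cosFT RF 0 - cosFT RF k) := by
  obtain ⟨cΦ, αΦ, cF, αF, ψ, π, lam, RΦ, RF, hRΦ, hRF, hform, -, -, -, -, -, -,
    hcΦ, hαΦ, hαF, -, -, hRΦle, hRFb, hcΦlow, hαFup, hRFle, hsΦ, hΔΦ, hsF, hΔF⟩ := h
  exact ⟨cΦ, αΦ, cF, αF, RΦ, RF, hRΦ, hRF, hform, hcΦlow, hcΦ, hαΦ, hαF, hαFup, hRΦle, hRFle, hsΦ, hΔΦ,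
    hsF, hΔF, hRFb⟩

/-- The DICTIONARY from the Assumption-2.7 constants (and the bootstrap constant `Γ₂`) to the ten `β`-arguments of
the typed `f₃` bound map `F3Bounds.boundH1..5` ((3.71)–(3.87)): `Γ₂′ = ((2d−2)/(2d−1)) Γ₂`,
`K̲ = 1/(α̲_F − β̲_{ΔR,F})`, the rest read off `B` and `E`.
[cite: FitznerVanDerHofstad2016NoBLE, §3.3.4, paragraph "Bounds on key quantities" (K̲ and Γ₂′), PTRF pp. 1071–1074] -/
def NobleBetaF3.toArgs (d : ℕ) (B : NobleBeta) (E : NobleBetaF3) (Γ₂ : ℝ) : F3Bounds.Args where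
  Gamma2dash := (2 * d - 2) / (2 * d - 1) * Γ₂
  cp := B.cΦup
  afmin := B.αFlow
  afmax := E.αFup
  ap := B.βαΦ
  bRf := E.βRF
  bRp := B.βRΦ
  bRfDelta := E.βΔRFabs
  bRpDelta := E.βΔRΦ
  Kunderline := 1 / (B.αFlow - B.βΔ)

/-- On the admissible region the dictionary lands in the well-formed arguments: `α̲_F > 0` and the listed
arguments `≥ 0` follow from `0 < α̲_F`, `β̲_{ΔR,F} < α̲_F`, `Γ₂ ≥ 0`, `d ≥ 1` and the nonnegativity of the
remaining constants. [folklore] -/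
theorem NobleBetaF3.toArgs_wf (hd : 1 ≤ d) {B : NobleBeta} {E : NobleBetaF3} {Γ₂ : ℝ}
    (hΓ : 0 ≤ Γ₂) (hαF : 0 < B.αFlow) (hgap : B.βΔ < B.αFlow) (hcp : 0 ≤ B.cΦup) (hap : 0 ≤ B.βαΦ)
    (hafmax : 0 ≤ E.αFup) (hbRp : 0 ≤ B.βRΦ) (hΔF : 0 ≤ E.βΔRFabs) (hΔΦ : 0 ≤ E.βΔRΦ) :
    (NobleBetaF3.toArgs d B E Γ₂).WF := by
  have hd' : (1 : ℝ) ≤ d := by exact_mod_cast hd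
  refine ⟨?_, hcp, hαF, hafmax, hap, hbRp, hΔF, hΔΦ, ?_⟩
  · show 0 ≤ (2 * (d : ℝ) - 2) / (2 * d - 1) * Γ₂
    exact mul_nonneg (div_nonneg (by linarith) (by linarith)) hΓ
  · show 0 ≤ 1 / (B.αFlow - B.βΔ)
    exact div_nonneg zero_le_one (by linarith)

end Literature.Probability.FitznerVanDerHofstad2017
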